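import Summits.CriticalPhenomena.PercolationContinuityZ3.Theorems.PercNearOneGluingNoHeavyPcintWinKernelSymCert
import Summits.CriticalPhenomena.PercolationContinuityZ3.Theorems.PercNearOneGluingNoHeavyPcintWinKernelRange
import HarnessLib

/-!
# PCINT lane, kernel B3r window certificate `d = 5`, memory 5 (4-step windows, 10000 codes) — table and chunk check

Cell `prim-pcint`, seat `prim-pcint-2` (gen 2); memo `run/shared/lean/prim/pcint/REDUCTIONS.md` §B3r, INTERVAL-PLAN §14.
Does NOT build on p205010.  Instance data for the generic theorem
`WinK.le_criticalProb_of_checkBK`: `p = 1140/10^4`, `s̄ = 9935/10^4 ≥ √(1-p²)`, refund `r = 10066/10^4`, `κ̄ = (10^4+9935)/(2·10^4)`; Collatz–Wielandt vector on the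
23 hyperoctahedral normal forms keyed by the Gram code of the window (integer scale `10^5`, found by power iteration and verified in exact arithmetic
off-line: max row ratio `143640450445494001/143705000000000000` < 1; `λ = 99999/10^5`).  The `10000` coded rows are checked (only on first-use normal forms, WinK.isNF) by `decide +kernel` in
`…KernZ5B5Check*`; result in `…KernZ5B5`: `p_c^bond(ℤ⁵) ≥ 0.1140`.
-/

namespace Summit.CriticalPhenomena.PercolationContinuityZ3.Theorems.Pcint

namespace Z5B5

set_option maxRecDepth 4000 in
/-- Certificate table, chunk 1/1 (`Gram code ↦ v`). [folklore] -/
def tbl1 : List (ℕ × ℕ) := [(14408200, 97088), (14408284, 97088), (14414770, 97088), (14421340, 95993), (14428612, 97416), (14435266, 97416), (14939668, 97088), (14960080, 97416), (15471136, 95102), (15491548, 96525), (16004710, 97589), (16011280, 97589), (16017850, 97589), (16536262, 97589), (17601220, 86223), (17607790, 87333), (18664240, 86188), (19368316, 99863), (19368400, 99863), (19906354, 99863), (20444392, 98744), (20985238, 100000), (21523360, 100000)]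


/-- The certificate table `Gram code ↦ v` (concatenation of the chunks). [folklore] -/
def tbl : List (ℕ × ℕ) := tbl1

/-- All table values lie in `[86188, 100000]`. [folklore] -/
theorem tbl_bounds : ∀ e ∈ tbl, 86188 ≤ e.2 ∧ e.2 ≤ 100000 := by decide +kernel

/-- The Collatz–Wielandt row check on the window codes `[lo, hi)`. [folklore] -/
def chk (lo hi : ℕ) : Bool := WinK.allRange (WinK.nfOKB 5 3 1140 10066 9935 99999 tbl 86188) lo hi

/-- Splitting a chunk check. [folklore] -/
theorem chk_split {lo mid hi : ℕ} (h1 : chk lo mid = true) (h2 : chk mid hi = true) : chk lo hi = true :=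
  WinK.allRange_split h1 h2

end Z5B5

end Summit.CriticalPhenomena.PercolationContinuityZ3.Theorems.Pcint
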